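import Literature.NumberTheory.Sieve.FGKMT2018RandomConstruction
import HarnessLib

/-!
# Ford–Green–Konyagin–Maynard–Tao 2018: Theorem 2 from Corollary 3 and Theorem 4 — PROOF

Topic `Literature/NumberTheory/Sieve`. Source: [FordGreenKonyaginMaynardTao2018] K. Ford, B. Green,
S. Konyagin, J. Maynard, T. Tao, *Long gaps between primes*, JAMS 31 (2018) = arXiv:1412.5029, §4.3,
the paragraph «We now show why Theorem 4 implies Theorem 2» (p. 13).

We PROVE the deduction
`FGKMT2018_corollary3 → FordGreenKonyaginMaynardTao2018_theorem4 → FordGreenKonyaginMaynardTao2018_theorem2`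
(`fgkmt2018_theorem2_of_corollary3_theorem4`), hence — with `fgkmt2018_theorem1_of_theorem2` — the
large-gap Theorem 1 and every Rankin constant from Corollary 3 (a kernel consequence-to-be of the
covering theorem, Theorem 3) and the random construction, Theorem 4.

The argument is the printed one: choose `c` so small that `C ≥ C₁/c ≥ (5/4) log 5` ((4.23) via
(4.29)); take `m = ⌊log₃ x / log 5⌋`; fix the good `a⃗` provided by Theorem 4 and discard the
`≤ x/(log x log₂ x)` exceptional primes; apply Corollary 3 on the vertex type
`V = (𝒬 ∩ S(a⃗)) ∖ E` with index type `ι = 𝒫` and the laws of the edges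
`𝐞_p = {𝐧_p + h p : h ∈ H} ∩ 𝒬 ∩ S(a⃗)` (push-forward of the law of `𝐧_p`); sparsity (4.20) is (4.26),
uniform covering (4.22) is goodness (4.28), and the small-codegree condition (4.24) holds because two
distinct primes of `(x, y]` differ by a non-zero integer `< y ≤ x log x < x²/4`, divisible by at most
one prime `p₀ > x/2`; the selected edges `e'_p` lie in single residue classes `n'_p mod p`, so
`b_p := n'_p mod p` leaves at most `#E + K 5^{-m} #V ≪ x / log x` sifted primes
(`5^{-m} ≤ 5 / log₂ x`, `#V ≤ 100 c x log₂ x / log x`).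

## Main statements
* `FGKMT2018.card_edge_le`, `FGKMT2018.int_modEq_of_mem_edge` — edges have `≤ #H` elements, all
  `≡ n (mod p)` [cite: FordGreenKonyaginMaynardTao2018, Thm 4].
* `fgkmt2018_theorem2_of_corollary3_theorem4` — Theorem 2 from Corollary 3 and Theorem 4
  [cite: FordGreenKonyaginMaynardTao2018, §4.3 (proof of Thm 2, p. 13)].
* `fgkmt2018_theorem1_of_corollary3_theorem4`, `rankinConstant_of_fgkmt2018_corollary3_theorem4` —
  the chain down to Theorem 1 / Rankin constants.
-/

open Finset Filter

namespace Literature.NumberTheory.Sieve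

open FGKMT2018 Literature.Combinatorics.Hypergraph Literature.Combinatorics.Hypergraph.FGKMTCovering

namespace FGKMT2018

/-- An edge `e_p(a⃗; n) = {n + h p : h ∈ H} ∩ 𝒬 ∩ S(a⃗)` has at most `#H` elements (`p ≠ 0`).
[cite: FordGreenKonyaginMaynardTao2018, Thm 4 («a tuple (h_1, …, h_r)», `#𝐞_p ≤ r`)] -/
theorem card_edge_le (c : ℝ) (x : ℕ) (a : ℕ → ℕ) (H : Finset ℤ) {p : ℕ} (hp : p ≠ 0) (n : ℤ) :
    #(edge c x a H p n) ≤ #H := by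
  classical
  have hp' : (p : ℤ) ≠ 0 := by exact_mod_cast hp
  refine Finset.card_le_card_of_injOn (fun q : ℕ => ((q : ℤ) - n) / p) (fun q hq => ?_)
    (fun q₁ hq₁ q₂ hq₂ h => ?_)
  · obtain ⟨-, h, hh, hq⟩ := Finset.mem_filter.1 hq
    have : ((q : ℤ) - n) / p = h := by
      rw [hq, add_sub_cancel_left, Int.mul_ediv_cancel _ hp']
    simpa [this] using hh
  · obtain ⟨-, h₁, -, h₁q⟩ := Finset.mem_filter.1 (Finset.mem_coe.1 hq₁)
    obtain ⟨-, h₂, -, h₂q⟩ := Finset.mem_filter.1 (Finset.mem_coe.1 hq₂)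
    have e₁ : ((q₁ : ℤ) - n) / p = h₁ := by rw [h₁q, add_sub_cancel_left, Int.mul_ediv_cancel _ hp']
    have e₂ : ((q₂ : ℤ) - n) / p = h₂ := by rw [h₂q, add_sub_cancel_left, Int.mul_ediv_cancel _ hp']
    have h12 : h₁ = h₂ := by rw [← e₁, ← e₂]; exact h
    have : (q₁ : ℤ) = q₂ := by rw [h₁q, h₂q, h12]
    exact_mod_cast this

/-- Every element of the edge `e_p(a⃗; n)` is `≡ n (mod p)`.
[cite: FordGreenKonyaginMaynardTao2018, §4.3 («`𝐞'_p = {𝐧'_p + h_i p} ∩ …` for some integer `𝐧'_p`»)] -/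
theorem int_modEq_of_mem_edge {c : ℝ} {x : ℕ} {a : ℕ → ℕ} {H : Finset ℤ} {p : ℕ} {n : ℤ} {q : ℕ}
    (hq : q ∈ edge c x a H p n) : (q : ℤ) ≡ n [ZMOD p] := by
  classical
  obtain ⟨-, h, -, hqn⟩ := Finset.mem_filter.1 hq
  rw [hqn]
  calc n + h * p ≡ n + 0 [ZMOD p] :=
        Int.ModEq.add_left _ (Int.modEq_zero_iff_dvd.2 (Dvd.intro_left h rfl))
    _ = n := add_zero n

/-- `edge ⊆ 𝒬 ∩ S(a⃗)`. [cite: FordGreenKonyaginMaynardTao2018, Thm 4] -/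
theorem edge_subset_sievedQ (c : ℝ) (x : ℕ) (a : ℕ → ℕ) (H : Finset ℤ) (p : ℕ) (n : ℤ) :
    edge c x a H p n ⊆ sievedQ c x a := Finset.filter_subset _ _

/-- Growth facts used in the deduction of Theorem 2, eventually in `x`. [folklore] -/
private theorem assembly_growth : ∀ᶠ x : ℕ in atTop,
    100 ≤ (x : ℝ) ∧ 1 ≤ Real.log x ∧ 1 ≤ Real.log (Real.log x) ∧
      1 ≤ Real.log (Real.log (Real.log x)) ∧
      (Real.log (Real.log x)) ^ 2 ≤ Real.sqrt (Real.log x) ∧ 8 * Real.log x ≤ (x : ℝ) := by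
  have hℓ : Tendsto (fun x : ℕ => Real.log x) atTop atTop :=
    Real.tendsto_log_atTop.comp tendsto_natCast_atTop_atTop
  have hℓ₂ : Tendsto (fun x : ℕ => Real.log (Real.log x)) atTop atTop :=
    Real.tendsto_log_atTop.comp hℓ
  have hℓ₃ : Tendsto (fun x : ℕ => Real.log (Real.log (Real.log x))) atTop atTop :=
    Real.tendsto_log_atTop.comp hℓ₂
  -- `(log₂ x)² ≤ √(log x)`: `log L ≤ L^{1/4}` for large `L = log x`
  have h4 : ∀ᶠ x : ℕ in atTop, (Real.log (Real.log x)) ^ 2 ≤ Real.sqrt (Real.log x) := by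
    have h := (isLittleO_log_rpow_atTop (show (0 : ℝ) < 1 / 4 by norm_num)).bound
      (show (0 : ℝ) < 1 by norm_num)
    filter_upwards [hℓ.eventually h, hℓ.eventually_ge_atTop 0, hℓ₂.eventually_ge_atTop 0]
      with x hx hL0 hL20
    have h1 : Real.log (Real.log (x : ℝ)) ≤ Real.log (x : ℝ) ^ ((1 : ℝ) / 4) := by
      have h1 := hx
      simp only [Real.norm_eq_abs, one_mul] at h1
      rw [abs_of_nonneg hL20, abs_of_nonneg (Real.rpow_nonneg hL0 _)] at h1
      exact h1
    calc (Real.log (Real.log (x : ℝ))) ^ 2 ≤ (Real.log (x : ℝ) ^ ((1 : ℝ) / 4)) ^ 2 :=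
          pow_le_pow_left₀ hL20 h1 2
      _ = Real.sqrt (Real.log x) := by
          rw [← Real.rpow_natCast, ← Real.rpow_mul hL0, Real.sqrt_eq_rpow]
          norm_num
  have h8 : ∀ᶠ x : ℕ in atTop, 8 * Real.log x ≤ (x : ℝ) := by
    have h := Real.isLittleO_log_id_atTop.bound (show (0 : ℝ) < 1 / 8 by norm_num)
    filter_upwards [tendsto_natCast_atTop_atTop.eventually h] with x hx
    have h1 : ‖Real.log (x : ℝ)‖ ≤ 1 / 8 * ‖(x : ℝ)‖ := by simpa only [id_eq] using hx
    rw [Real.norm_eq_abs, Real.norm_eq_abs, abs_of_nonneg (Nat.cast_nonneg (α := ℝ) x)] at h1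
    linarith [le_abs_self (Real.log (x : ℝ))]
  filter_upwards [tendsto_natCast_atTop_atTop.eventually_ge_atTop (100 : ℝ),
    hℓ.eventually_ge_atTop 1, hℓ₂.eventually_ge_atTop 1, hℓ₃.eventually_ge_atTop 1, h4, h8]
    with x h1 h2 h3 h4 h5 h6
  exact ⟨h1, h2, h3, h4, h5, h6⟩

/-- For a nonnegative law, `P(v₁, v₂ ∈ 𝐞) ≤ P(v₁ ∈ 𝐞)` (monotonicity of probability, used in the
small-codegree verification on p. 13). [cite: FordGreenKonyaginMaynardTao2018, §4.3 (4.24) via (4.26)] -/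
theorem probPairMem_le_probMem {V : Type*} [Fintype V] [DecidableEq V] {μ : Finset V → ℝ}
    (hμ : ∀ S, 0 ≤ μ S) (v₁ v₂ : V) : probPairMem μ v₁ v₂ ≤ probMem μ v₁ := by
  unfold probPairMem probMem
  exact Finset.sum_le_sum_of_subset_of_nonneg
    (fun S hS => by
      simp only [Finset.mem_filter, Finset.mem_univ, true_and] at hS ⊢
      exact hS.1)
    (fun S _ _ => hμ S)

/-- `Real.log^[2]`, `Real.log^[3]` unfolded. [folklore] -/
private theorem iterate_log_two_three (w : ℝ) :
    Real.log^[2] w = Real.log (Real.log w) ∧ Real.log^[3] w = Real.log (Real.log (Real.log w)) := by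
  constructor <;> simp [Function.iterate_succ_apply']

end FGKMT2018

set_option maxHeartbeats 1600000 in
/-- **Theorem 2 from Corollary 3 and Theorem 4** [FordGreenKonyaginMaynardTao2018, §4.3, p. 13]:
the specialised covering corollary (first-moment form) and the random construction
(deterministic-in-`a⃗` form) give residue classes `a⃗`, `b⃗` with `#(𝒬 ∩ S(a⃗) ∩ S(b⃗)) ≪ x / log x`.
[cite: FordGreenKonyaginMaynardTao2018, Thm 2 (deduction from Cor 3 and Thm 4, §4.3)] -/
theorem fgkmt2018_theorem2_of_corollary3_theorem4 (h3 : FGKMT2018_corollary3)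
    (h4 : FordGreenKonyaginMaynardTao2018_theorem4) :
    FordGreenKonyaginMaynardTao2018_theorem2 := by
  classical
  obtain ⟨C₁, C₂, hC₁, hC₁₂, h4⟩ := h4
  -- the constant `c`: `C₁ / c ≥ 5 ≥ (5/4) log 5`
  set c : ℝ := min 1 (C₁ / 5) with hc_def
  have hc : 0 < c := lt_min one_pos (by positivity)
  have hc1 : c ≤ 1 := min_le_left _ _
  have hcC : 5 / 4 * Real.log 5 ≤ C₁ / c := by
    have hlog5 : Real.log 5 ≤ 4 := by
      have := Real.log_le_sub_one_of_pos (show (0 : ℝ) < 5 by norm_num)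
      linarith
    have h5 : (5 : ℝ) ≤ C₁ / c := by
      rw [le_div_iff₀ hc]
      have : c ≤ C₁ / 5 := min_le_right _ _
      linarith
    linarith
  obtain ⟨K, hK, h3⟩ := h3 1 (C₂ / c) one_pos (div_pos (hC₁.trans_le hC₁₂) hc)
  refine ⟨c, hc, 1 + 500 * K * c, ?_⟩
  filter_upwards [h4 c hc hc1, h3, assembly_growth] with x hx4 hx3 hgrow
  obtain ⟨hx100, hℓ1, hℓ₂1, hℓ₃1, hℓ₂sq, h8log⟩ := hgrow
  obtain ⟨i2, i3⟩ := iterate_log_two_three (x : ℝ)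
  simp only [i2, i3] at hx3 hx4
  obtain ⟨C, hCl, hCu, H, a, N, ν, hH, hν, hsp, hVcard, E, hEs, hEc, hgood⟩ := hx4
  -- abbreviations and elementary facts
  set ℓ : ℝ := Real.log x with hℓ
  set ℓ₂ : ℝ := Real.log ℓ with hℓ₂
  set ℓ₃ : ℝ := Real.log ℓ₂ with hℓ₃
  have hx0 : (0 : ℝ) < x := by linarith
  have hx1 : (1 : ℝ) ≤ x := by linarith
  have hℓ0 : 0 < ℓ := by linarith
  have hℓ₂0 : 0 < ℓ₂ := by linarith
  have hlog5 : 0 < Real.log 5 := Real.log_pos (by norm_num)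
  have hy : ySieve c x ≤ x * ℓ := by
    have h32 : ℓ₃ ≤ ℓ₂ := (Real.log_le_sub_one_of_pos hℓ₂0).trans (by linarith)
    have h1 : (x : ℝ) * ℓ * ℓ₃ / ℓ₂ ≤ x * ℓ := by
      rw [div_le_iff₀ hℓ₂0]
      have : (0 : ℝ) ≤ x * ℓ := by positivity
      nlinarith
    calc ySieve c x = c * ((x : ℝ) * ℓ * ℓ₃ / ℓ₂) := rfl
      _ ≤ 1 * ((x : ℝ) * ℓ) := by
          apply mul_le_mul hc1 h1 (by positivity) zero_le_one
      _ = x * ℓ := one_mul _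
  have hy4 : 4 * ySieve c x < (x : ℝ) ^ 2 := by nlinarith
  have hy0 : 0 ≤ ySieve c x := by
    show 0 ≤ c * ((x : ℝ) * ℓ * ℓ₃ / ℓ₂)
    exact mul_nonneg hc.le (div_nonneg (mul_nonneg (by positivity) (by linarith)) hℓ₂0.le)
  -- the vertex set `V = (𝒬 ∩ S(a⃗)) ∖ E` and the index set `ι = 𝒫`
  set P : Finset ℕ := primesHalf x with hP
  set S : Finset ℕ := sievedQ c x a \ E with hS
  have hSsub : S ⊆ sievedQ c x a := Finset.sdiff_subset
  have hmemP : ∀ {p : ℕ}, p ∈ P → p.Prime ∧ x < 2 * p ∧ p ≤ x := by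
    intro p hp
    simp only [hP, primesHalf, Finset.mem_filter, Finset.mem_Icc] at hp
    exact ⟨hp.2.1, hp.2.2, hp.1.2⟩
  have hmemQ : ∀ {q : ℕ}, q ∈ sievedQ c x a → x + 1 ≤ q ∧ q ≤ ⌊ySieve c x⌋₊ := by
    intro q hq
    simp only [sievedQ, primesQ, Finset.mem_filter, Finset.mem_Icc] at hq
    exact ⟨hq.1.1.1, hq.1.1.2⟩
  -- laws of the edges `𝐞_p = {𝐧_p + h p} ∩ 𝒬 ∩ S(a⃗)` on `V`
  set eV : ℕ → ℤ → Finset S := fun p n =>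
    Finset.univ.filter (fun v : S => (v : ℕ) ∈ edge c x a H p n) with heV
  set μ : P → Finset S → ℝ := fun i T => ∑ n ∈ N with eV i n = T, ν i n with hμ
  have hμnn : ∀ i T, 0 ≤ μ i T := fun i T => Finset.sum_nonneg fun n _ => (hν i i.2).1 n
  have hμlaw : ∀ i, IsLaw (μ i) := fun i =>
    ⟨hμnn i, by
      show ∑ T, ∑ n ∈ N with eV i n = T, ν i n = 1
      rw [Finset.sum_fiberwise N (eV i) (ν (i : ℕ))]
      exact (hν i i.2).2.2⟩
  have hμsupp : ∀ i T, μ i T ≠ 0 → ∃ n ∈ N, ν i n ≠ 0 ∧ eV i n = T := by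
    intro i T hT
    obtain ⟨n, hn, hn0⟩ := Finset.exists_ne_zero_of_sum_ne_zero hT
    rw [Finset.mem_filter] at hn
    exact ⟨n, hn.1, hn0, hn.2⟩
  have hmem_eV : ∀ (p : ℕ) (n : ℤ) (v : S), v ∈ eV p n ↔ (v : ℕ) ∈ edge c x a H p n := by
    intro p n v
    simp [heV]
  have hcard_eV : ∀ (i : P) (n : ℤ), (#(eV i n) : ℝ) ≤ Real.sqrt ℓ := by
    intro i n
    have hi0 : (i : ℕ) ≠ 0 := (hmemP i.2).1.ne_zero
    have h1 : #(eV i n) ≤ #(edge c x a H i n) :=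
      Finset.card_le_card_of_injOn Subtype.val (fun v hv => (hmem_eV i n v).1 hv)
        (Set.injOn_of_injective Subtype.val_injective)
    have h2 := card_edge_le c x a H hi0 n
    calc (#(eV i n) : ℝ) ≤ #H := by exact_mod_cast h1.trans h2
      _ ≤ Real.sqrt ℓ := hH
  have hpm : ∀ (i : P) (v : S), probMem (μ i) v = probInEdge c x a H N ν i v := by
    intro i v
    show ∑ T ∈ Finset.univ.filter (fun T => v ∈ T), ∑ n ∈ N with eV i n = T, ν i n = _
    rw [Finset.sum_fiberwise_eq_sum_filter N _ (eV i) (ν (i : ℕ))]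
    unfold probInEdge
    refine Finset.sum_congr ?_ (fun _ _ => rfl)
    ext n
    simp only [Finset.mem_filter, Finset.mem_univ, true_and, hmem_eV]
  -- the parameters of Corollary 3
  set m : ℕ := ⌊ℓ₃ / Real.log 5⌋₊ with hm_def
  have hm : (m : ℝ) ≤ ℓ₃ / Real.log 5 := Nat.floor_le (div_nonneg (by linarith) hlog5.le)
  set r : ℝ := Real.sqrt ℓ with hr
  have hr1 : 1 ≤ r := by
    rw [hr, show (1 : ℝ) = Real.sqrt 1 from Real.sqrt_one.symm]
    exact Real.sqrt_le_sqrt hℓ1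
  have hrr : r * r = ℓ := Real.mul_self_sqrt hℓ0.le
  have hrK : r ≤ 1 * (ℓ * ℓ₃ / ℓ₂ ^ 2) := by
    rw [one_mul, le_div_iff₀ (by positivity)]
    have h0 : 0 ≤ r := Real.sqrt_nonneg _
    calc r * ℓ₂ ^ 2 ≤ r * r := mul_le_mul_of_nonneg_left hℓ₂sq h0
      _ = ℓ * 1 := by rw [hrr, mul_one]
      _ ≤ ℓ * ℓ₃ := mul_le_mul_of_nonneg_left hℓ₃1 hℓ0.le
  have hι : (Fintype.card P : ℝ) ≤ x := by
    rw [Fintype.card_coe]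
    have : #P ≤ #(Finset.Icc 1 x) := Finset.card_filter_le _ _
    rw [Nat.card_Icc, Nat.add_sub_cancel] at this
    exact_mod_cast this
  have hScard : (#S : ℝ) ≤ 100 * c * ((x : ℝ) * ℓ₂ / ℓ) :=
    (by exact_mod_cast Finset.card_le_card hSsub : (#S : ℝ) ≤ #(sievedQ c x a)).trans hVcard
  have hV : (Fintype.card S : ℝ) ≤ (x : ℝ) ^ 2 := by
    rw [Fintype.card_coe]
    have h21 : ℓ₂ / ℓ ≤ 1 := by
      rw [div_le_one hℓ0]
      exact (Real.log_le_sub_one_of_pos hℓ0).trans (by linarith)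
    calc (#S : ℝ) ≤ 100 * c * ((x : ℝ) * ℓ₂ / ℓ) := hScard
      _ = 100 * c * x * (ℓ₂ / ℓ) := by ring
      _ ≤ 100 * 1 * x * 1 := by
          apply mul_le_mul (by nlinarith) h21 (by positivity) (by positivity)
      _ ≤ (x : ℝ) ^ 2 := by nlinarith
  have hsuppr : ∀ i T, μ i T ≠ 0 → (#T : ℝ) ≤ r := by
    intro i T hT
    obtain ⟨n, -, -, hnT⟩ := hμsupp i T hT
    rw [← hnT]
    exact hcard_eV i n
  have hsparse : ∀ i v, probMem (μ i) v ≤ (x : ℝ) ^ (-(3 / 5 : ℝ)) := by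
    intro i v
    rw [hpm]
    exact hsp i i.2 v (hSsub v.2)
  have hcover : ∀ v : S, |∑ i, probMem (μ i) v - C| ≤ 1 / ℓ₂ ^ 2 := by
    intro v
    simp_rw [hpm]
    rw [Finset.sum_coe_sort P (fun p => probInEdge c x a H N ν p v)]
    have hv := Finset.mem_sdiff.1 v.2
    exact hgood v hv.1 hv.2
  have hcodeg : ∀ v₁ v₂ : S, v₁ ≠ v₂ →
      ∑ i, probPairMem (μ i) v₁ v₂ ≤ (x : ℝ) ^ (-(1 / 20 : ℝ)) := by
    intro v₁ v₂ hne
    have hD : ((v₁ : ℕ) : ℤ) - ((v₂ : ℕ) : ℤ) ≠ 0 :=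
      sub_ne_zero.2 (by exact_mod_cast fun h => hne (Subtype.ext h))
    -- an index with positive pair-mass divides the difference
    have hdiv : ∀ i : P, probPairMem (μ i) v₁ v₂ ≠ 0 →
        ((i : ℕ) : ℤ) ∣ ((v₁ : ℕ) : ℤ) - ((v₂ : ℕ) : ℤ) := by
      intro i hi
      obtain ⟨T, hT, hT0⟩ := Finset.exists_ne_zero_of_sum_ne_zero hi
      simp only [Finset.mem_filter, Finset.mem_univ, true_and] at hT
      obtain ⟨n, -, -, hnT⟩ := hμsupp i T hT0
      rw [← hnT] at hT
      have h1 : ((v₁ : ℕ) : ℤ) ≡ n [ZMOD (i : ℕ)] :=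
        int_modEq_of_mem_edge ((hmem_eV i n v₁).1 hT.1)
      have h2 : ((v₂ : ℕ) : ℤ) ≡ n [ZMOD (i : ℕ)] :=
        int_modEq_of_mem_edge ((hmem_eV i n v₂).1 hT.2)
      exact (h2.trans h1.symm).dvd
    have hx35 : (x : ℝ) ^ (-(3 / 5 : ℝ)) ≤ (x : ℝ) ^ (-(1 / 20 : ℝ)) :=
      Real.rpow_le_rpow_of_exponent_le hx1 (by norm_num)
    by_cases hex : ∃ i : P, probPairMem (μ i) v₁ v₂ ≠ 0
    · obtain ⟨i₀, hi₀⟩ := hex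
      have hothers : ∀ i : P, i ≠ i₀ → probPairMem (μ i) v₁ v₂ = 0 := by
        intro i hi
        by_contra hne0
        obtain ⟨hp, hpx, -⟩ := hmemP i.2
        obtain ⟨hp₀, hp₀x, -⟩ := hmemP i₀.2
        have hne' : (i : ℕ) ≠ (i₀ : ℕ) := fun h => hi (Subtype.ext h)
        have hcop : Nat.Coprime (i : ℕ) (i₀ : ℕ) := (Nat.coprime_primes hp hp₀).2 hne'
        have hdvdN : (i : ℕ) * (i₀ : ℕ) ∣ (((v₁ : ℕ) : ℤ) - ((v₂ : ℕ) : ℤ)).natAbs :=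
          hcop.mul_dvd_of_dvd_of_dvd (Int.natCast_dvd.1 (hdiv i hne0))
            (Int.natCast_dvd.1 (hdiv i₀ hi₀))
        have hle : (i : ℕ) * (i₀ : ℕ) ≤ (((v₁ : ℕ) : ℤ) - ((v₂ : ℕ) : ℤ)).natAbs :=
          Nat.le_of_dvd (Int.natAbs_pos.2 hD) hdvdN
        obtain ⟨h₁l, h₁u⟩ := hmemQ (hSsub v₁.2)
        obtain ⟨h₂l, h₂u⟩ := hmemQ (hSsub v₂.2)
        have hab : (((v₁ : ℕ) : ℤ) - ((v₂ : ℕ) : ℤ)).natAbs ≤ ⌊ySieve c x⌋₊ := by omega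
        have hyfl : (⌊ySieve c x⌋₊ : ℝ) ≤ ySieve c x := Nat.floor_le hy0
        have hprod : ((i : ℕ) : ℝ) * ((i₀ : ℕ) : ℝ) ≤ ySieve c x := by
          have h1 : (((i : ℕ) * (i₀ : ℕ) : ℕ) : ℝ) ≤ (⌊ySieve c x⌋₊ : ℝ) := by
            exact_mod_cast hle.trans hab
          push_cast at h1
          exact h1.trans hyfl
        have h4 : (x : ℝ) * x < 4 * (((i : ℕ) : ℝ) * ((i₀ : ℕ) : ℝ)) := by
          have h1' : (x : ℝ) < 2 * ((i : ℕ) : ℝ) := by exact_mod_cast hpx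
          have h2' : (x : ℝ) < 2 * ((i₀ : ℕ) : ℝ) := by exact_mod_cast hp₀x
          nlinarith
        nlinarith
      rw [Finset.sum_eq_single i₀ (fun i _ hi => hothers i hi) (fun h => (h (Finset.mem_univ _)).elim)]
      exact ((probPairMem_le_probMem (hμnn i₀) v₁ v₂).trans (hsparse i₀ v₁)).trans hx35
    · push Not at hex
      rw [Finset.sum_eq_zero (fun i _ => hex i)]
      positivity
  -- apply Corollary 3
  obtain ⟨ω, hωs, hωc⟩ := hx3 S P r C m μ hι hV hr1 hrK (hcC.trans hCl) hCu hm hμlaw hsuppr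
    hsparse hcover hcodeg
  -- the classes `b_p := n'_p mod p`
  have hch : ∀ i : P, ∃ n : ℤ, ω i ≠ ∅ → eV i n = ω i := by
    intro i
    rcases hωs i with h | h
    · exact ⟨0, fun h' => (h' h).elim⟩
    · obtain ⟨n, -, -, hnT⟩ := hμsupp i _ h
      exact ⟨n, fun _ => hnT⟩
  choose nsel hnsel using hch
  let b : ℕ → ℕ := fun p => if hp : p ∈ P then ((nsel ⟨p, hp⟩) % (p : ℤ)).toNat else 0
  refine ⟨a, b, ?_⟩
  -- sifted primes are exceptional or uncovered
  have hsub : siftedPrimes c x a b ⊆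
      E ∪ (Finset.univ.filter (fun v : S => ∀ i : P, v ∉ ω i)).map
        (Function.Embedding.subtype (· ∈ S)) := by
    intro q hq
    rw [siftedPrimes, Finset.mem_filter] at hq
    by_cases hqE : q ∈ E
    · exact Finset.mem_union_left _ hqE
    refine Finset.mem_union_right _ ?_
    have hqS : q ∈ S := by
      rw [hS, Finset.mem_sdiff]
      refine ⟨?_, hqE⟩
      rw [sievedQ, Finset.mem_filter]
      exact ⟨hq.1, hq.2.1⟩
    rw [Finset.mem_map]
    refine ⟨⟨q, hqS⟩, ?_, rfl⟩
    simp only [Finset.mem_filter, Finset.mem_univ, true_and]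
    intro i hvi
    have hne : ω i ≠ ∅ := Finset.ne_empty_of_mem hvi
    have hnT := hnsel i hne
    rw [← hnT] at hvi
    have hqedge : q ∈ edge c x a H i (nsel i) := (hmem_eV i (nsel i) ⟨q, hqS⟩).1 hvi
    have hmod : (q : ℤ) ≡ nsel i [ZMOD (i : ℕ)] := int_modEq_of_mem_edge hqedge
    have hi0 : ((i : ℕ) : ℤ) ≠ 0 := by exact_mod_cast (hmemP i.2).1.ne_zero
    have hbi : (b i : ℤ) = nsel i % ((i : ℕ) : ℤ) := by
      have : b i = ((nsel ⟨i, i.2⟩) % ((i : ℕ) : ℤ)).toNat := dif_pos i.2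
      rw [this, Subtype.coe_eta, Int.toNat_of_nonneg (Int.emod_nonneg _ hi0)]
    have hmod' : (q : ℤ) ≡ (b i : ℤ) [ZMOD (i : ℕ)] := by
      rw [hbi]
      exact hmod.trans (Int.mod_modEq _ _).symm
    exact hq.2.2 i i.2 (Int.natCast_modEq_iff.1 hmod')
  have hcardle : (#(siftedPrimes c x a b) : ℝ) ≤
      #E + #(Finset.univ.filter (fun v : S => ∀ i : P, v ∉ ω i)) := by
    have := (Finset.card_le_card hsub).trans (Finset.card_union_le _ _)
    rw [Finset.card_map] at this
    exact_mod_cast this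
  -- `5^{-m} ≤ 5 / log₂ x`
  have h5m : ℓ₂ / 5 ≤ (5 : ℝ) ^ m := by
    have hmgt : ℓ₃ / Real.log 5 < m + 1 := Nat.lt_floor_add_one _
    have h1 : ℓ₃ - Real.log 5 ≤ m * Real.log 5 := by
      have := mul_lt_mul_of_pos_right hmgt hlog5
      rw [div_mul_cancel₀ _ hlog5.ne'] at this
      linarith
    calc ℓ₂ / 5 = Real.exp (ℓ₃ - Real.log 5) := by
          rw [Real.exp_sub, hℓ₃, Real.exp_log hℓ₂0, Real.exp_log (by norm_num)]
      _ ≤ Real.exp (m * Real.log 5) := Real.exp_le_exp.2 h1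
      _ = (5 : ℝ) ^ m := by
          rw [← Real.rpow_natCast, Real.rpow_def_of_pos (by norm_num : (0 : ℝ) < 5), mul_comm]
  have hKm : K / 5 ^ m ≤ 5 * K / ℓ₂ := by
    rw [div_le_div_iff₀ (by positivity) hℓ₂0]
    have := mul_le_mul_of_nonneg_left h5m hK.le
    nlinarith
  -- final count
  have hfil : (#(Finset.univ.filter (fun v : S => ∀ i : P, v ∉ ω i)) : ℝ) ≤ 500 * K * c * (x / ℓ) := by
    have hFS : (Fintype.card S : ℝ) = #S := by rw [Fintype.card_coe]
    calc (#(Finset.univ.filter (fun v : S => ∀ i : P, v ∉ ω i)) : ℝ)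
        ≤ K / 5 ^ m * Fintype.card S := hωc
      _ ≤ 5 * K / ℓ₂ * (100 * c * ((x : ℝ) * ℓ₂ / ℓ)) := by
          rw [hFS]
          exact mul_le_mul hKm hScard (by positivity) (by positivity)
      _ = 500 * K * c * (x / ℓ) := by
          field_simp
          ring
  have hEle : (#E : ℝ) ≤ x / ℓ := by
    calc (#E : ℝ) ≤ x / (ℓ * ℓ₂) := hEc
      _ ≤ x / ℓ := by
          rw [div_le_div_iff₀ (by positivity) hℓ0]
          have : (0 : ℝ) ≤ x * ℓ := by positivity
          nlinarith
  calc (#(siftedPrimes c x a b) : ℝ)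
      ≤ #E + #(Finset.univ.filter (fun v : S => ∀ i : P, v ∉ ω i)) := hcardle
    _ ≤ x / ℓ + 500 * K * c * (x / ℓ) := add_le_add hEle hfil
    _ = (1 + 500 * K * c) * ((x : ℝ) / Real.log x) := by rw [hℓ]; ring

/-- **Theorem 1 of FGKMT (the large-gap bound `G(X) ≫ log X log₂ X log₄ X / log₃ X`) from
Corollary 3 and Theorem 4.** [cite: FordGreenKonyaginMaynardTao2018, Thm 1 (from Cor 3, Thm 4)] -/
theorem fgkmt2018_theorem1_of_corollary3_theorem4 (h3 : FGKMT2018_corollary3)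
    (h4 : FordGreenKonyaginMaynardTao2018_theorem4) : FordGreenKonyaginMaynardTao2018_theorem1 :=
  fgkmt2018_theorem1_of_theorem2 (fgkmt2018_theorem2_of_corollary3_theorem4 h3 h4)

/-- Every Rankin constant from Corollary 3 and Theorem 4 of FGKMT.
[cite: FordGreenKonyaginMaynardTao2018, Thm 1 (from Cor 3, Thm 4)] -/
theorem rankinConstant_of_fgkmt2018_corollary3_theorem4 (h3 : FGKMT2018_corollary3)
    (h4 : FordGreenKonyaginMaynardTao2018_theorem4) (κ : ℝ) : RankinConstant κ :=
  rankinConstant_of_fgkmt2018_theorem2 (fgkmt2018_theorem2_of_corollary3_theorem4 h3 h4) κ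

end Literature.NumberTheory.Sieve
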